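import Literature.Probability.Percolation.TileDomain
import Literature.Probability.Percolation.QuadCrossingBottomCluster
import HarnessLib

/-!
# Crossings of the tile-domain quad are docking walks (the semantic bridge)

Topic `Probability/Percolation`.  Eighth step of the cell-complex toolkit for the gluing theorem
(Schramm–Smirnov 2011, proof of Thm 1.5, step (C)).  In cell coordinates (`TileCells.lean`: the
percolation vertex `x` sits at the centre of its site cell `σ x`, the edge `{x, x + e_k}` is drawn as
the two-step centre segment `cellSeg x k` through the bond cell `β x k`), a connected subset of the
drawn open edges inside `K = Kset 𝒯.U` that meets two sets `S₀`, `S₂` of boundary points ("the quad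
is crossed between these arcs") is the same thing as an **open docking walk**: open edges whose
contact points `cpt` (midpoints of the cell sides where drawn edges cross `∂K`) lie in `S₀`, `S₂`,
joined through sites of the domain by open edges (whose bond cells are then in the domain, by the
no-slit lemma).

* `cpt`, `cellSeg`, `cellDrawing`; `cellSeg_inter_cellSeg` — distinct drawn edges meet only at
  the centre of a common endpoint; `mem_sqCell_ctr_iff` — a cell centre lies in one closed cell;
* `TileData.exists_connected_of_chain` — (⇐) a docking walk spans a connected subset of the
  drawing inside `K` through the two contact points;
* `TileData.exists_chain_of_connected` — (⇒) from a connected subset of the open drawing inside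
  `K` meeting `S₀` and `S₂` (sets of non-centre points), an open docking walk between contact
  darts whose contact points lie in `S₀`, `S₂` (chains of pieces,
  `exists_reflTransGen_of_isPreconnected`).

Everything is proved; no named fact is introduced.

## References

* O. Schramm, S. Smirnov, Ann. Probab. 39 (2011), arXiv:1101.5820, proof of Thm 1.5 (C). [SchrammSmirnov2011]
* G. Grimmett, *Percolation* (1999), §11.2. [GrimmettPercolation1999]
-/

noncomputable section

open Set Metric Relation
open Literature.Probability.LatticeModels

namespace Literature.Probability.Percolation

namespace CellComplex

/-! ### The drawing in cell coordinates -/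

/-- The drawn edge from `x` in direction `k`: the segment from the centre of `σ x` to the centre of
`σ (x + e_k)`. [folklore] -/
def cellSeg (x : Site 2) (k : Fin 4) : Set ℂ := seg2Pt (σc x) k '' Icc 0 1

/-- The drawn edge is the centre segment. [folklore] -/
theorem cellSeg_eq_segment (x : Site 2) (k : Fin 4) :
    cellSeg x k = segment ℝ (ctr (σc x)) (ctr (σc (x + cornerUnit k))) := by
  rw [cellSeg, σc_add_cornerUnit, segment_ctr_eq_image]

/-- The **contact point** of the dart `(x, k)`: the midpoint of the cell side between `σ x` and
`β x k`, where the drawn edge leaves the site cell. [folklore] -/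
def cpt (x : Site 2) (k : Fin 4) : ℂ := seg2Pt (σc x) k (1 / 4)

/-- The contact point lies on the drawn edge. [folklore] -/
theorem cpt_mem_cellSeg (x : Site 2) (k : Fin 4) : cpt x k ∈ cellSeg x k :=
  ⟨1 / 4, ⟨by norm_num, by norm_num⟩, rfl⟩

/-- The contact point lies in the site cell and in the bond cell. [folklore] -/
theorem cpt_mem (x : Site 2) (k : Fin 4) : cpt x k ∈ sqCell (σc x) ∧ cpt x k ∈ sqCell (βc x k) := by
  obtain ⟨h1, h2, -, -⟩ := seg2Pt_quarter_mem (σc x) k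
  exact ⟨h1, by rw [βc_eq]; exact h2⟩

/-- Reversing the dart reverses the drawn edge. [folklore] -/
theorem cellSeg_rev (x : Site 2) (k : Fin 4) : cellSeg (x + cornerUnit k) (k + 2) = cellSeg x k := by
  rw [cellSeg_eq_segment, cellSeg_eq_segment, cornerUnit_add_two, show x + cornerUnit k + -cornerUnit k = x by abel,
    segment_symm]

/-- The points of the drawn edge in coordinates. [folklore] -/
theorem seg2Pt_σc_re_im (x : Site 2) (k : Fin 4) (t : ℝ) :
    (seg2Pt (σc x) k t).re = 2 * x 0 + 1 / 2 + 2 * t * (Site.toComplex (cornerUnit k)).re ∧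
      (seg2Pt (σc x) k t).im = 2 * x 1 + 1 / 2 + 2 * t * (Site.toComplex (cornerUnit k)).im := by
  simp only [seg2Pt, Complex.add_re, Complex.add_im, Complex.mul_re, Complex.mul_im, Complex.ofReal_re,
    Complex.ofReal_im, zero_mul, sub_zero, add_zero, ctr_re, ctr_im, σc_apply]
  push_cast
  exact ⟨by ring, by ring⟩

/-- The centre of `σ v` in coordinates. [folklore] -/
theorem ctr_σc_re_im (v : Site 2) : (ctr (σc v)).re = 2 * v 0 + 1 / 2 ∧ (ctr (σc v)).im = 2 * v 1 + 1 / 2 := by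
  simp only [ctr_re, ctr_im, σc_apply]; push_cast; exact ⟨rfl, rfl⟩

/-- **A cell centre lies in exactly one closed cell.** [folklore] -/
theorem mem_sqCell_ctr_iff {c c' : Site 2} : ctr c ∈ sqCell c' ↔ c' = c := by
  rw [sqCell, Complex.mem_reProdIm, mem_Icc, mem_Icc, ctr_re, ctr_im]
  constructor
  · rintro ⟨⟨h1, h2⟩, h3, h4⟩
    have a : (c' 0 : ℝ) < c 0 + 1 := by linarith
    have b : (c 0 : ℝ) < c' 0 + 1 := by linarith
    have a' : c' 0 < c 0 + 1 := by exact_mod_cast a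
    have b' : c 0 < c' 0 + 1 := by exact_mod_cast b
    have d : (c' 1 : ℝ) < c 1 + 1 := by linarith
    have e : (c 1 : ℝ) < c' 1 + 1 := by linarith
    have d' : c' 1 < c 1 + 1 := by exact_mod_cast d
    have e' : c 1 < c' 1 + 1 := by exact_mod_cast e
    funext i; fin_cases i <;> simp only [Fin.zero_eta, Fin.mk_one] <;> omega
  · rintro rfl
    refine ⟨⟨by linarith, by linarith⟩, by linarith, by linarith⟩

/-- The centre of `σ v` is in `K` iff `σ v ∈ U`. [folklore] -/
theorem ctr_σc_mem_Kset_iff {U : Finset (Site 2)} {v : Site 2} : ctr (σc v) ∈ Kset U ↔ σc v ∈ U := by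
  rw [Kset, mem_iUnion₂]
  constructor
  · rintro ⟨c, hc, h⟩; rw [mem_sqCell_ctr_iff.1 h] at hc; exact hc
  · intro h; exact ⟨_, h, mem_sqCell_ctr_iff.2 rfl⟩

/-- Every dart has a presentation with direction `0` or `1` and the same drawn edge. [folklore] -/
theorem exists_dart_dir_le_one (x : Site 2) (k : Fin 4) :
    ∃ (x₀ : Site 2) (k₀ : Fin 4), (k₀ = 0 ∨ k₀ = 1) ∧ dartEdge x k = dartEdge x₀ k₀ ∧ cellSeg x k = cellSeg x₀ k₀ := by
  match k with
  | 0 => exact ⟨x, 0, Or.inl rfl, rfl, rfl⟩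
  | 1 => exact ⟨x, 1, Or.inr rfl, rfl, rfl⟩
  | 2 =>
    refine ⟨x + cornerUnit 2, 0, Or.inl rfl, ?_, ?_⟩
    · rw [← dartEdge_rev x 2]; rfl
    · rw [← cellSeg_rev x 2]; rfl
  | 3 =>
    refine ⟨x + cornerUnit 3, 1, Or.inr rfl, ?_, ?_⟩
    · rw [← dartEdge_rev x 3]; rfl
    · rw [← cellSeg_rev x 3]; rfl

/-- A real number in `[0, 1]` equal to an integer is `0` or `1`. [folklore] -/
theorem eq_zero_or_one_of_eq_int {t : ℝ} (ht : t ∈ Icc (0 : ℝ) 1) {n : ℤ} (h : t = n) : (t = 0 ∧ n = 0) ∨ (t = 1 ∧ n = 1) := by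
  have h0 : (0 : ℝ) ≤ n := h ▸ ht.1
  have h1 : (n : ℝ) ≤ 1 := h ▸ ht.2
  have h0' : 0 ≤ n := by exact_mod_cast h0
  have h1' : n ≤ 1 := by exact_mod_cast h1
  rcases (show n = 0 ∨ n = 1 by omega) with rfl | rfl
  · left; exact ⟨by rw [h]; simp, rfl⟩
  · right; exact ⟨by rw [h]; simp, rfl⟩

/-- Coordinates of the drawn edge in direction `0`. [folklore] -/
theorem seg2Pt_σc_zero (x : Site 2) (t : ℝ) :
    (seg2Pt (σc x) 0 t).re = 2 * x 0 + 1 / 2 + 2 * t ∧ (seg2Pt (σc x) 0 t).im = 2 * x 1 + 1 / 2 := by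
  obtain ⟨h1, h2⟩ := seg2Pt_σc_re_im x 0 t
  rw [toComplex_cornerUnit_table] at h1 h2
  simp only [Complex.one_re, Complex.one_im, mul_one, mul_zero, add_zero] at h1 h2
  exact ⟨h1, h2⟩

/-- Coordinates of the drawn edge in direction `1`. [folklore] -/
theorem seg2Pt_σc_one (x : Site 2) (t : ℝ) :
    (seg2Pt (σc x) 1 t).re = 2 * x 0 + 1 / 2 ∧ (seg2Pt (σc x) 1 t).im = 2 * x 1 + 1 / 2 + 2 * t := by
  obtain ⟨h1, h2⟩ := seg2Pt_σc_re_im x 1 t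
  rw [toComplex_cornerUnit_table] at h1 h2
  simp only [Complex.I_re, Complex.I_im, mul_one, mul_zero, add_zero] at h1 h2
  exact ⟨h1, h2⟩

/-- A point with the coordinates of a cell centre is that centre. [folklore] -/
theorem eq_ctr_σc_of_re_im {p : ℂ} {v : Site 2} (hre : p.re = 2 * v 0 + 1 / 2) (him : p.im = 2 * v 1 + 1 / 2) :
    p = ctr (σc v) :=
  Complex.ext (by rw [hre, (ctr_σc_re_im v).1]) (by rw [him, (ctr_σc_re_im v).2])

/-- Distinct drawn edges in directions `0`/`1` meet only at the centre of a common endpoint. [folklore] -/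
theorem cellSeg_inter_cellSeg_aux {x x' : Site 2} {k k' : Fin 4} (hk : k = 0 ∨ k = 1) (hk' : k' = 0 ∨ k' = 1)
    {p : ℂ} (hp : p ∈ cellSeg x k) (hp' : p ∈ cellSeg x' k') (hne : dartEdge x k ≠ dartEdge x' k') :
    ∃ v, v ∈ dartEdge x k ∧ v ∈ dartEdge x' k' ∧ p = ctr (σc v) := by
  obtain ⟨t, ht, rfl⟩ := hp
  obtain ⟨t', ht', heq⟩ := hp'
  have e0 : ∀ y : Site 2, y + cornerUnit 0 = fun i => if i = 0 then y 0 + 1 else y 1 := fun y => by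
    funext i; fin_cases i <;> simp [cornerUnit]
  have e1 : ∀ y : Site 2, y + cornerUnit 1 = fun i => if i = 0 then y 0 else y 1 + 1 := fun y => by
    funext i; fin_cases i <;> simp [cornerUnit]
  rcases hk with rfl | rfl <;> rcases hk' with rfl | rfl
  · -- both horizontal
    obtain ⟨hre, him⟩ := seg2Pt_σc_zero x t
    obtain ⟨hre', him'⟩ := seg2Pt_σc_zero x' t'
    rw [heq] at hre' him'
    have h1 : x' 1 = x 1 := by
      have : (x' 1 : ℝ) = x 1 := by linarith
      exact_mod_cast this
    have hd : t - t' = ((x' 0 - x 0 : ℤ) : ℝ) := by push_cast; linarith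
    have hdI : t - t' ∈ Icc (-1 : ℝ) 1 := ⟨by linarith [ht.1, ht'.2], by linarith [ht.2, ht'.1]⟩
    have hn : x' 0 - x 0 = -1 ∨ x' 0 - x 0 = 0 ∨ x' 0 - x 0 = 1 := by
      have a : (-1 : ℝ) ≤ (x' 0 - x 0 : ℤ) := hd ▸ hdI.1
      have b : ((x' 0 - x 0 : ℤ) : ℝ) ≤ 1 := hd ▸ hdI.2
      have a' : -1 ≤ x' 0 - x 0 := by exact_mod_cast a
      have b' : x' 0 - x 0 ≤ 1 := by exact_mod_cast b
      omega
    rcases hn with hn | hn | hn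
    · -- `x' = x - e₀`: `t = 0`, the point is the centre of `x`
      rw [hn] at hd
      have ht0 : t = 0 := by push_cast at hd; linarith [ht.1, ht'.2]
      refine ⟨x, mem_dartEdge_iff.2 (Or.inl rfl), mem_dartEdge_iff.2 (Or.inr ?_), eq_ctr_σc_of_re_im (by rw [hre, ht0]; ring) him⟩
      rw [e0]; funext i; fin_cases i <;> simp <;> omega
    · exfalso
      apply hne
      have : x' = x := by funext i; fin_cases i <;> simp only [Fin.zero_eta, Fin.mk_one] <;> omega
      rw [this]
    · rw [hn] at hd
      have ht1 : t = 1 := by push_cast at hd; linarith [ht.2, ht'.1]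
      refine ⟨x', mem_dartEdge_iff.2 (Or.inr ?_), mem_dartEdge_iff.2 (Or.inl rfl), eq_ctr_σc_of_re_im ?_ ?_⟩
      · rw [e0]; funext i; fin_cases i <;> simp <;> omega
      · rw [hre, ht1]; have : (x' 0 : ℝ) = x 0 + 1 := by exact_mod_cast (by omega : x' 0 = x 0 + 1)
        rw [this]; ring
      · rw [him, h1]
  · -- horizontal / vertical
    obtain ⟨hre, him⟩ := seg2Pt_σc_zero x t
    obtain ⟨hre', him'⟩ := seg2Pt_σc_one x' t'
    rw [heq] at hre' him'
    have htn : t = ((x' 0 - x 0 : ℤ) : ℝ) := by push_cast; linarith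
    have htn' : t' = ((x 1 - x' 1 : ℤ) : ℝ) := by push_cast; linarith
    set v : Site 2 := fun i => if i = 0 then x' 0 else x 1 with hv
    refine ⟨v, mem_dartEdge_iff.2 ?_, mem_dartEdge_iff.2 ?_, eq_ctr_σc_of_re_im (by rw [hre', hv]; simp) (by rw [him, hv]; simp)⟩
    · rcases eq_zero_or_one_of_eq_int ht htn with ⟨-, hn⟩ | ⟨-, hn⟩
      · left; funext i; fin_cases i <;> simp [hv]; omega
      · right; rw [e0]; funext i; fin_cases i <;> simp [hv]; omega
    · rcases eq_zero_or_one_of_eq_int ht' htn' with ⟨-, hn⟩ | ⟨-, hn⟩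
      · left; funext i; fin_cases i <;> simp [hv]; omega
      · right; rw [e1]; funext i; fin_cases i <;> simp [hv]; omega
  · -- vertical / horizontal
    obtain ⟨hre, him⟩ := seg2Pt_σc_one x t
    obtain ⟨hre', him'⟩ := seg2Pt_σc_zero x' t'
    rw [heq] at hre' him'
    have htn : t = ((x' 1 - x 1 : ℤ) : ℝ) := by push_cast; linarith
    have htn' : t' = ((x 0 - x' 0 : ℤ) : ℝ) := by push_cast; linarith
    set v : Site 2 := fun i => if i = 0 then x 0 else x' 1 with hv
    refine ⟨v, mem_dartEdge_iff.2 ?_, mem_dartEdge_iff.2 ?_, eq_ctr_σc_of_re_im (by rw [hre, hv]; simp) (by rw [him', hv]; simp)⟩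
    · rcases eq_zero_or_one_of_eq_int ht htn with ⟨-, hn⟩ | ⟨-, hn⟩
      · left; funext i; fin_cases i <;> simp [hv]; omega
      · right; rw [e1]; funext i; fin_cases i <;> simp [hv]; omega
    · rcases eq_zero_or_one_of_eq_int ht' htn' with ⟨-, hn⟩ | ⟨-, hn⟩
      · left; funext i; fin_cases i <;> simp [hv]; omega
      · right; rw [e0]; funext i; fin_cases i <;> simp [hv]; omega
  · -- both vertical
    obtain ⟨hre, him⟩ := seg2Pt_σc_one x t
    obtain ⟨hre', him'⟩ := seg2Pt_σc_one x' t'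
    rw [heq] at hre' him'
    have h0 : x' 0 = x 0 := by
      have : (x' 0 : ℝ) = x 0 := by linarith
      exact_mod_cast this
    have hd : t - t' = ((x' 1 - x 1 : ℤ) : ℝ) := by push_cast; linarith
    have hdI : t - t' ∈ Icc (-1 : ℝ) 1 := ⟨by linarith [ht.1, ht'.2], by linarith [ht.2, ht'.1]⟩
    have hn : x' 1 - x 1 = -1 ∨ x' 1 - x 1 = 0 ∨ x' 1 - x 1 = 1 := by
      have a : (-1 : ℝ) ≤ (x' 1 - x 1 : ℤ) := hd ▸ hdI.1
      have b : ((x' 1 - x 1 : ℤ) : ℝ) ≤ 1 := hd ▸ hdI.2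
      have a' : -1 ≤ x' 1 - x 1 := by exact_mod_cast a
      have b' : x' 1 - x 1 ≤ 1 := by exact_mod_cast b
      omega
    rcases hn with hn | hn | hn
    · rw [hn] at hd
      have ht0 : t = 0 := by push_cast at hd; linarith [ht.1, ht'.2]
      refine ⟨x, mem_dartEdge_iff.2 (Or.inl rfl), mem_dartEdge_iff.2 (Or.inr ?_), eq_ctr_σc_of_re_im hre (by rw [him, ht0]; ring)⟩
      rw [e1]; funext i; fin_cases i <;> simp <;> omega
    · exfalso
      apply hne
      have : x' = x := by funext i; fin_cases i <;> simp only [Fin.zero_eta, Fin.mk_one] <;> omega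
      rw [this]
    · rw [hn] at hd
      have ht1 : t = 1 := by push_cast at hd; linarith [ht.2, ht'.1]
      refine ⟨x', mem_dartEdge_iff.2 (Or.inr ?_), mem_dartEdge_iff.2 (Or.inl rfl), eq_ctr_σc_of_re_im ?_ ?_⟩
      · rw [e1]; funext i; fin_cases i <;> simp <;> omega
      · rw [hre, h0]
      · rw [him, ht1]; have : (x' 1 : ℝ) = x 1 + 1 := by exact_mod_cast (by omega : x' 1 = x 1 + 1)
        rw [this]; ring

/-- **Distinct drawn edges meet only at the centre of a common endpoint.** [folklore] -/
theorem cellSeg_inter_cellSeg {x x' : Site 2} {k k' : Fin 4} {p : ℂ} (hp : p ∈ cellSeg x k) (hp' : p ∈ cellSeg x' k')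
    (hne : dartEdge x k ≠ dartEdge x' k') :
    ∃ v, v ∈ dartEdge x k ∧ v ∈ dartEdge x' k' ∧ p = ctr (σc v) := by
  obtain ⟨x₀, k₀, hk₀, hd, hs⟩ := exists_dart_dir_le_one x k
  obtain ⟨x₀', k₀', hk₀', hd', hs'⟩ := exists_dart_dir_le_one x' k'
  rw [hd, hd'] at hne ⊢
  rw [hs] at hp
  rw [hs'] at hp'
  exact cellSeg_inter_cellSeg_aux hk₀ hk₀' hp hp' hne

/-! ### Points of the drawn edge inside the open cells -/

/-- For `t < 1/4` the drawn point lies in the open site cell. [folklore] -/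
theorem seg2Pt_mem_sqOpen_σc {x : Site 2} {k : Fin 4} {t : ℝ} (ht0 : 0 ≤ t) (ht : t < 1 / 4) :
    seg2Pt (σc x) k t ∈ sqOpen (σc x) := by
  obtain ⟨hre, him⟩ := seg2Pt_σc_re_im x k t
  rw [sqOpen, Complex.mem_reProdIm, mem_Ioo, mem_Ioo, hre, him, σc_apply, σc_apply]
  push_cast
  refine ⟨⟨?_, ?_⟩, ?_, ?_⟩
  all_goals
    fin_cases k <;> rw [toComplex_cornerUnit_table] <;>
      simp only [Complex.one_re, Complex.one_im, Complex.I_re, Complex.I_im, Complex.neg_re, Complex.neg_im,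
        neg_zero, mul_zero, mul_one, mul_neg, add_zero] <;> linarith

/-- For `1/4 < t < 3/4` the drawn point lies in the open bond cell. [folklore] -/
theorem seg2Pt_mem_sqOpen_βc {x : Site 2} {k : Fin 4} {t : ℝ} (ht0 : 1 / 4 < t) (ht : t < 3 / 4) :
    seg2Pt (σc x) k t ∈ sqOpen (βc x k) := by
  obtain ⟨hre, him⟩ := seg2Pt_σc_re_im x k t
  rw [sqOpen, Complex.mem_reProdIm, mem_Ioo, mem_Ioo, hre, him, βc_apply, βc_apply, cornerUnit_apply_zero,
    cornerUnit_apply_one]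
  push_cast
  refine ⟨⟨?_, ?_⟩, ?_, ?_⟩
  all_goals
    fin_cases k <;> rw [toComplex_cornerUnit_table] <;>
      simp only [Complex.one_re, Complex.one_im, Complex.I_re, Complex.I_im, Complex.neg_re, Complex.neg_im,
        neg_zero, mul_zero, mul_one, mul_neg, add_zero] <;> push_cast <;> linarith

/-- The reversed parametrisation. [folklore] -/
theorem seg2Pt_rev (x : Site 2) (k : Fin 4) (t : ℝ) :
    seg2Pt (σc (x + cornerUnit k)) (k + 2) (1 - t) = seg2Pt (σc x) k t := by
  simp only [seg2Pt, σc_add_cornerUnit, ctr, cornerUnit_add_two, toComplex_add]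
  have : Site.toComplex (-cornerUnit k) = -Site.toComplex (cornerUnit k) := by
    apply Complex.ext <;> simp
  rw [this]; push_cast; ring

/-- **A drawn point on the frontier of `K` is a contact point** of a boundary side: it is
`cpt x k` or `cpt (x + e_k) (k + 2)`, with exactly one of the two cells of that side in `U`. [folklore] -/
theorem exists_cpt_of_mem_frontier {U : Finset (Site 2)} {x : Site 2} {k : Fin 4} {p : ℂ} (hp : p ∈ cellSeg x k)
    (hfr : p ∈ frontier (Kset U)) :
    ∃ (y : Site 2) (m : Fin 4), dartEdge y m = dartEdge x k ∧ p = cpt y m ∧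
      ((σc y ∈ U ∧ βc y m ∉ U) ∨ (σc y ∉ U ∧ βc y m ∈ U)) := by
  rw [frontier, (isClosed_Kset U).closure_eq] at hfr
  obtain ⟨hpK, hpint⟩ := hfr
  -- interior points of cells of `U` are interior, open cells outside `U` miss `K`
  have key : ∀ c, p ∈ sqOpen c → False := by
    intro c hc
    by_cases hcU : c ∈ U
    · exact hpint (sqOpen_subset_interior hcU hc)
    · exact Set.disjoint_left.1 (sqOpen_disjoint_Kset hcU) hc hpK
  obtain ⟨t, ht, rfl⟩ := hp
  -- `t` is `1/4` or `3/4`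
  have ht14 : t = 1 / 4 ∨ t = 3 / 4 := by
    by_contra hne
    push Not at hne
    rcases lt_or_gt_of_ne hne.1 with h1 | h1
    · exact key _ (seg2Pt_mem_sqOpen_σc ht.1 h1)
    · rcases lt_or_gt_of_ne hne.2 with h2 | h2
      · exact key _ (seg2Pt_mem_sqOpen_βc h1 h2)
      · -- `t > 3/4`: in the open cell of the far site, via the reversed dart
        have h := seg2Pt_mem_sqOpen_σc (x := x + cornerUnit k) (k := k + 2) (t := 1 - t) (by linarith [ht.2]) (by linarith)
        rw [seg2Pt_rev] at h
        exact key _ h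
  -- the dichotomy at a contact point: the two cells of its side
  have side : ∀ (y : Site 2) (m : Fin 4), seg2Pt (σc y) m (1 / 4) ∈ Kset U → seg2Pt (σc y) m (1 / 4) ∉ interior (Kset U) →
      (σc y ∈ U ∧ βc y m ∉ U) ∨ (σc y ∉ U ∧ βc y m ∈ U) := by
    intro y m hK hint
    -- cells containing the contact point: only `σc y` and `βc y m`
    have hcells : ∀ c, seg2Pt (σc y) m (1 / 4) ∈ sqCell c → c = σc y ∨ c = βc y m := by
      intro c hc
      rcases exists_of_seg2Pt_mem_sqCell (c := σc y) ⟨by norm_num, by norm_num⟩ hc with h | h | h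
      · exact Or.inl h
      · exact Or.inr (by rw [h, βc_eq])
      · -- the far site cell does not contain the quarter point
        exfalso
        rw [h, ← σc_add_cornerUnit] at hc
        rw [sqCell, Complex.mem_reProdIm, mem_Icc, mem_Icc] at hc
        obtain ⟨⟨h1, h2⟩, h3, h4⟩ := hc
        obtain ⟨hre, him⟩ := seg2Pt_σc_re_im y m (1 / 4)
        rw [hre, σc_apply, Pi.add_apply, cornerUnit_apply_zero] at h1 h2
        rw [him, σc_apply, Pi.add_apply, cornerUnit_apply_one] at h3 h4
        push_cast at h1 h2 h3 h4
        fin_cases m <;> rw [toComplex_cornerUnit_table] at h1 h2 h3 h4 <;>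
          simp only [Complex.one_re, Complex.one_im, Complex.I_re, Complex.I_im, Complex.neg_re, Complex.neg_im,
            neg_zero, mul_zero, mul_one, mul_neg, add_zero] at h1 h2 h3 h4 <;> push_cast at h1 h2 h3 h4 <;> linarith
    by_cases hS : σc y ∈ U <;> by_cases hB : βc y m ∈ U
    · -- both in: the contact point is interior (a ball of radius `1/2` lies in the two cells)
      exfalso
      apply hint
      rw [mem_interior]
      refine ⟨ball (seg2Pt (σc y) m (1 / 4)) (1 / 2), ?_, isOpen_ball, mem_ball_self (by norm_num)⟩
      intro q hq
      rw [mem_ball, Complex.dist_eq] at hq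
      have hqre := Complex.abs_re_le_norm (q - seg2Pt (σc y) m (1 / 4))
      have hqim := Complex.abs_im_le_norm (q - seg2Pt (σc y) m (1 / 4))
      rw [Complex.sub_re] at hqre
      rw [Complex.sub_im] at hqim
      obtain ⟨hre, him⟩ := seg2Pt_σc_re_im y m (1 / 4)
      rw [hre] at hqre
      rw [him] at hqim
      rw [abs_le] at hqre hqim
      -- `q` is in `σc y` or in `βc y m`, by the coordinate across the side
      have memS : ∀ c : Site 2, (c 0 : ℝ) ≤ q.re → q.re ≤ c 0 + 1 → (c 1 : ℝ) ≤ q.im → q.im ≤ c 1 + 1 → q ∈ sqCell c :=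
        fun c h1 h2 h3 h4 => ⟨⟨h1, h2⟩, h3, h4⟩
      fin_cases m <;> rw [toComplex_cornerUnit_table] at hqre hqim <;>
        simp only [Complex.one_re, Complex.one_im, Complex.I_re, Complex.I_im, Complex.neg_re, Complex.neg_im,
          neg_zero, mul_zero, mul_one, mul_neg, add_zero] at hqre hqim
      · by_cases hq0 : q.re ≤ 2 * y 0 + 1
        · exact sqCell_subset_Kset hS (memS _ (by rw [σc_apply]; push_cast; linarith) (by rw [σc_apply]; push_cast; linarith)
            (by rw [σc_apply]; push_cast; linarith) (by rw [σc_apply]; push_cast; linarith))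
        · exact sqCell_subset_Kset hB (memS _ (by rw [βc_apply]; simp [cornerUnit]; linarith)
            (by rw [βc_apply]; simp [cornerUnit]; linarith) (by rw [βc_apply]; simp [cornerUnit]; linarith)
            (by rw [βc_apply]; simp [cornerUnit]; linarith))
      · by_cases hq0 : q.im ≤ 2 * y 1 + 1
        · exact sqCell_subset_Kset hS (memS _ (by rw [σc_apply]; push_cast; linarith) (by rw [σc_apply]; push_cast; linarith)
            (by rw [σc_apply]; push_cast; linarith) (by rw [σc_apply]; push_cast; linarith))
        · exact sqCell_subset_Kset hB (memS _ (by rw [βc_apply]; simp [cornerUnit]; linarith)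
            (by rw [βc_apply]; simp [cornerUnit]; linarith) (by rw [βc_apply]; simp [cornerUnit]; linarith)
            (by rw [βc_apply]; simp [cornerUnit]; linarith))
      · by_cases hq0 : 2 * y 0 ≤ q.re
        · exact sqCell_subset_Kset hS (memS _ (by rw [σc_apply]; push_cast; linarith) (by rw [σc_apply]; push_cast; linarith)
            (by rw [σc_apply]; push_cast; linarith) (by rw [σc_apply]; push_cast; linarith))
        · exact sqCell_subset_Kset hB (memS _ (by rw [βc_apply]; simp [cornerUnit]; linarith)
            (by rw [βc_apply]; simp [cornerUnit]; linarith) (by rw [βc_apply]; simp [cornerUnit]; linarith)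
            (by rw [βc_apply]; simp [cornerUnit]; linarith))
      · by_cases hq0 : 2 * y 1 ≤ q.im
        · exact sqCell_subset_Kset hS (memS _ (by rw [σc_apply]; push_cast; linarith) (by rw [σc_apply]; push_cast; linarith)
            (by rw [σc_apply]; push_cast; linarith) (by rw [σc_apply]; push_cast; linarith))
        · exact sqCell_subset_Kset hB (memS _ (by rw [βc_apply]; simp [cornerUnit]; linarith)
            (by rw [βc_apply]; simp [cornerUnit]; linarith) (by rw [βc_apply]; simp [cornerUnit]; linarith)
            (by rw [βc_apply]; simp [cornerUnit]; linarith))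
    · exact Or.inl ⟨hS, hB⟩
    · exact Or.inr ⟨hS, hB⟩
    · -- both out: the contact point is not in `K`
      exfalso
      rw [Kset, mem_iUnion₂] at hK
      obtain ⟨c, hcU, hc⟩ := hK
      rcases hcells c hc with rfl | rfl
      · exact hS hcU
      · exact hB hcU
  rcases ht14 with rfl | rfl
  · exact ⟨x, k, rfl, rfl, side x k hpK hpint⟩
  · refine ⟨x + cornerUnit k, k + 2, dartEdge_rev x k, ?_, side _ _ ?_ ?_⟩
    · rw [cpt, seg2Pt_rev x k (3 / 4) |>.symm.trans ?_]; norm_num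
    · have := seg2Pt_rev x k (3 / 4); norm_num at this; rw [this]; exact hpK
    · have := seg2Pt_rev x k (3 / 4); norm_num at this; rw [this]; exact hpint

/-! ### The open drawing and open steps -/

/-- **The open drawing in cell coordinates**: the drawn edges of the open darts. [folklore] -/
def drawnC (ω : BondConfig (Site 2)) : Set ℂ := ⋃ (x : Site 2) (k : Fin 4) (_ : dartEdge x k ∈ ω), cellSeg x k

/-- Membership in the open drawing. [folklore] -/
theorem mem_drawnC_iff {ω : BondConfig (Site 2)} {p : ℂ} : p ∈ drawnC ω ↔ ∃ x k, dartEdge x k ∈ ω ∧ p ∈ cellSeg x k := by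
  simp only [drawnC, mem_iUnion, exists_prop]

/-- **An open step** between sites of the domain: an open edge joining two sites whose site cells
are in `U` (its bond cell is then in `U` as soon as `U` has no slit there). [folklore] -/
def OpenStep (U : Finset (Site 2)) (ω : BondConfig (Site 2)) (a b : Site 2) : Prop :=
  σc a ∈ U ∧ σc b ∈ U ∧ ∃ k : Fin 4, b = a + cornerUnit k ∧ dartEdge a k ∈ ω

/-- The drawn edge is convex. [folklore] -/
theorem convex_cellSeg (x : Site 2) (k : Fin 4) : Convex ℝ (cellSeg x k) := by
  rw [cellSeg_eq_segment]; exact convex_segment _ _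

/-- The drawn edge is connected. [folklore] -/
theorem isConnected_cellSeg (x : Site 2) (k : Fin 4) : IsConnected (cellSeg x k) := by
  rw [cellSeg_eq_segment]
  exact ⟨⟨_, left_mem_segment _ _ _⟩, (convex_segment _ _).isPreconnected⟩

/-- The endpoints of the drawn edge. [folklore] -/
theorem ctr_mem_cellSeg (x : Site 2) (k : Fin 4) :
    ctr (σc x) ∈ cellSeg x k ∧ ctr (σc (x + cornerUnit k)) ∈ cellSeg x k := by
  rw [cellSeg_eq_segment]; exact ⟨left_mem_segment _ _ _, right_mem_segment _ _ _⟩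

/-- For `0 ≤ t ≤ 1/4` the drawn point lies in the closed site cell. [folklore] -/
theorem seg2Pt_mem_sqCell_σc {x : Site 2} {k : Fin 4} {t : ℝ} (ht0 : 0 ≤ t) (ht : t ≤ 1 / 4) :
    seg2Pt (σc x) k t ∈ sqCell (σc x) := by
  obtain ⟨hre, him⟩ := seg2Pt_σc_re_im x k t
  rw [sqCell, Complex.mem_reProdIm, mem_Icc, mem_Icc, hre, him, σc_apply, σc_apply]
  push_cast
  refine ⟨⟨?_, ?_⟩, ?_, ?_⟩
  all_goals
    fin_cases k <;> rw [toComplex_cornerUnit_table] <;>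
      simp only [Complex.one_re, Complex.one_im, Complex.I_re, Complex.I_im, Complex.neg_re, Complex.neg_im,
        neg_zero, mul_zero, mul_one, mul_neg, add_zero] <;> linarith

/-- For `1/4 ≤ t ≤ 3/4` the drawn point lies in the closed bond cell. [folklore] -/
theorem seg2Pt_mem_sqCell_βc {x : Site 2} {k : Fin 4} {t : ℝ} (ht0 : 1 / 4 ≤ t) (ht : t ≤ 3 / 4) :
    seg2Pt (σc x) k t ∈ sqCell (βc x k) := by
  obtain ⟨hre, him⟩ := seg2Pt_σc_re_im x k t
  rw [sqCell, Complex.mem_reProdIm, mem_Icc, mem_Icc, hre, him, βc_apply, βc_apply, cornerUnit_apply_zero,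
    cornerUnit_apply_one]
  push_cast
  refine ⟨⟨?_, ?_⟩, ?_, ?_⟩
  all_goals
    fin_cases k <;> rw [toComplex_cornerUnit_table] <;>
      simp only [Complex.one_re, Complex.one_im, Complex.I_re, Complex.I_im, Complex.neg_re, Complex.neg_im,
        neg_zero, mul_zero, mul_one, mul_neg, add_zero] <;> push_cast <;> linarith

/-- For `3/4 ≤ t ≤ 1` the drawn point lies in the closed far site cell. [folklore] -/
theorem seg2Pt_mem_sqCell_far {x : Site 2} {k : Fin 4} {t : ℝ} (ht0 : 3 / 4 ≤ t) (ht : t ≤ 1) :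
    seg2Pt (σc x) k t ∈ sqCell (σc (x + cornerUnit k)) := by
  obtain ⟨hre, him⟩ := seg2Pt_σc_re_im x k t
  rw [sqCell, Complex.mem_reProdIm, mem_Icc, mem_Icc, hre, him, σc_apply, σc_apply, Pi.add_apply, Pi.add_apply,
    cornerUnit_apply_zero, cornerUnit_apply_one]
  push_cast
  refine ⟨⟨?_, ?_⟩, ?_, ?_⟩
  all_goals
    fin_cases k <;> rw [toComplex_cornerUnit_table] <;>
      simp only [Complex.one_re, Complex.one_im, Complex.I_re, Complex.I_im, Complex.neg_re, Complex.neg_im,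
        neg_zero, mul_zero, mul_one, mul_neg, add_zero] <;> push_cast <;> linarith

/-- The drawn edge of an open step lies in `K` when there is no slit. [folklore] -/
theorem cellSeg_subset_Kset {U : Finset (Site 2)} {x : Site 2} {k : Fin 4} (h1 : σc x ∈ U) (h2 : βc x k ∈ U)
    (h3 : σc (x + cornerUnit k) ∈ U) : cellSeg x k ⊆ Kset U := by
  rintro _ ⟨t, ht, rfl⟩
  by_cases ht1 : t ≤ 1 / 4
  · exact sqCell_subset_Kset h1 (seg2Pt_mem_sqCell_σc ht.1 ht1)
  by_cases ht2 : t ≤ 3 / 4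
  · exact sqCell_subset_Kset h2 (seg2Pt_mem_sqCell_βc (by linarith) ht2)
  · exact sqCell_subset_Kset h3 (seg2Pt_mem_sqCell_far (by linarith) ht.2)

/-- `seg2Pt` is affine. [folklore] -/
theorem lineMap_seg2Pt (c : Site 2) (k : Fin 4) (s s' θ : ℝ) :
    AffineMap.lineMap (seg2Pt c k s) (seg2Pt c k s') θ = seg2Pt c k (s + θ * (s' - s)) := by
  simp only [AffineMap.lineMap_apply_module', seg2Pt, Complex.real_smul]
  push_cast; ring

/-- `seg2Pt` is affine: sub-segments are images of sub-intervals. [folklore] -/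
theorem segment_seg2Pt_eq_image (c : Site 2) (k : Fin 4) {s s' : ℝ} (hss' : s ≤ s') :
    segment ℝ (seg2Pt c k s) (seg2Pt c k s') = seg2Pt c k '' Icc s s' := by
  rw [segment_eq_image_lineMap]
  apply Subset.antisymm
  · rintro _ ⟨θ, hθ, rfl⟩
    exact ⟨s + θ * (s' - s), ⟨by nlinarith [hθ.1, hθ.2], by nlinarith [hθ.1, hθ.2]⟩, (lineMap_seg2Pt c k s s' θ).symm⟩
  · rintro _ ⟨t, ht, rfl⟩
    rcases eq_or_lt_of_le hss' with heq | hlt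
    · subst heq
      have : t = s := le_antisymm ht.2 ht.1
      subst this
      exact ⟨0, ⟨le_rfl, zero_le_one⟩, by rw [lineMap_seg2Pt]; ring_nf⟩
    · refine ⟨(t - s) / (s' - s), ⟨div_nonneg (by linarith [ht.1]) (by linarith), (div_le_one (by linarith)).2 (by linarith [ht.2])⟩, ?_⟩
      rw [lineMap_seg2Pt]
      congr 1
      field_simp
      ring

/-- **The inner site of a contact dart**: `x` itself if its site cell is in `U` (an exterior
contact), else the far endpoint (a hub contact). [folklore] -/
def innerSite (U : Finset (Site 2)) (x : Site 2) (k : Fin 4) : Site 2 := by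
  classical exact if σc x ∈ U then x else x + cornerUnit k

/-- The inner site is an endpoint of the contact edge. [folklore] -/
theorem innerSite_mem (U : Finset (Site 2)) (x : Site 2) (k : Fin 4) : innerSite U x k ∈ dartEdge x k := by
  classical
  unfold innerSite
  split_ifs
  · exact mem_dartEdge_iff.2 (Or.inl rfl)
  · exact mem_dartEdge_iff.2 (Or.inr rfl)

/-- Under the **inner-site property** of `U` (every bond cell of `U` at a site outside `U` has its
far site in `U`), the inner site of a boundary contact dart has its site cell in `U` and the drawn
segment from the contact point to its centre lies in `K`. [folklore] -/
theorem innerSite_spec {U : Finset (Site 2)} (hinner : ∀ x k, σc x ∉ U → βc x k ∈ U → σc (x + cornerUnit k) ∈ U)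
    {x : Site 2} {k : Fin 4} (hside : (σc x ∈ U ∧ βc x k ∉ U) ∨ (σc x ∉ U ∧ βc x k ∈ U)) :
    σc (innerSite U x k) ∈ U ∧ segment ℝ (cpt x k) (ctr (σc (innerSite U x k))) ⊆ Kset U := by
  classical
  unfold innerSite
  rcases hside with ⟨hS, hB⟩ | ⟨hS, hB⟩
  · rw [if_pos hS]
    refine ⟨hS, ?_⟩
    -- the first quarter of the drawn edge, backwards, inside the site cell
    have h0 : ctr (σc x) = seg2Pt (σc x) k 0 := by simp [seg2Pt]
    rw [cpt, h0, segment_symm, segment_seg2Pt_eq_image _ _ (by norm_num : (0 : ℝ) ≤ 1 / 4)]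
    rintro _ ⟨t, ht, rfl⟩
    exact sqCell_subset_Kset hS (seg2Pt_mem_sqCell_σc ht.1 ht.2)
  · rw [if_neg hS]
    refine ⟨hinner x k hS hB, ?_⟩
    have h1 : ctr (σc (x + cornerUnit k)) = seg2Pt (σc x) k 1 := by
      have := (ctr_mem_cellSeg x k).2
      simp [seg2Pt, σc_add_cornerUnit, ctr, toComplex_add]; ring
    rw [cpt, h1, segment_seg2Pt_eq_image _ _ (by norm_num : (1 / 4 : ℝ) ≤ 1)]
    rintro _ ⟨t, ht, rfl⟩
    by_cases ht2 : t ≤ 3 / 4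
    · exact sqCell_subset_Kset hB (seg2Pt_mem_sqCell_βc ht.1 ht2)
    · exact sqCell_subset_Kset (hinner x k hS hB) (seg2Pt_mem_sqCell_far (by linarith) ht.2)

/-! ### (⇐) An open docking walk spans a connected subset of the open drawing -/

/-- Along a chain of open steps with no slits, a connected subset of the open drawing inside `K`
through the centres of the two end sites (or the chain is trivial). [folklore] -/
theorem exists_connected_of_openStep {U : Finset (Site 2)} {ω : BondConfig (Site 2)}
    (hslit : ∀ x k, σc x ∈ U → σc (x + cornerUnit k) ∈ U → βc x k ∈ U) {a b : Site 2}
    (h : ReflTransGen (OpenStep U ω) a b) :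
    a = b ∨ ∃ S : Set ℂ, IsCompact S ∧ IsConnected S ∧ S ⊆ drawnC ω ∧ S ⊆ Kset U ∧ ctr (σc a) ∈ S ∧ ctr (σc b) ∈ S := by
  induction h with
  | refl => exact Or.inl rfl
  | @tail b c _ hst ih =>
    obtain ⟨hbU, hcU, k, rfl, hopen⟩ := hst
    have hseg : cellSeg b k ⊆ drawnC ω := fun p hp => mem_drawnC_iff.2 ⟨b, k, hopen, hp⟩
    have hsegK : cellSeg b k ⊆ Kset U := cellSeg_subset_Kset hbU (hslit b k hbU hcU) hcU
    have hsegc : IsCompact (cellSeg b k) := isCompact_Icc.image_of_continuousOn (continuous_seg2Pt _ _).continuousOn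
    obtain ⟨hl, hr⟩ := ctr_mem_cellSeg b k
    rcases ih with rfl | ⟨S, hSc, hS, hSO, hSK, haS, hbS⟩
    · exact Or.inr ⟨cellSeg _ k, hsegc, isConnected_cellSeg _ k, hseg, hsegK, hl, hr⟩
    · refine Or.inr ⟨S ∪ cellSeg b k, hSc.union hsegc, hS.union ⟨_, hbS, hl⟩ (isConnected_cellSeg b k), union_subset hSO hseg,
        union_subset hSK hsegK, Or.inl haS, Or.inr hr⟩

/-- **(⇐) Docking walks give crossings.**  Given two open contact darts `(x, k)`, `(x', k')` with
inner sites `a ∈ {x, x + e_k}`, `a' ∈ {x', x' + e_{k'}}` in the domain, the initial segments from the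
contact points to the inner centres inside `K`, and a chain of open steps from `a` to `a'` (no slits),
there is a connected subset of the open drawing inside `K` containing both contact points.
[cite: SchrammSmirnov2011, proof of Thm 1.5 (C)] -/
theorem exists_connected_of_chain {U : Finset (Site 2)} {ω : BondConfig (Site 2)}
    (hslit : ∀ x k, σc x ∈ U → σc (x + cornerUnit k) ∈ U → βc x k ∈ U)
    {x x' a a' : Site 2} {k k' : Fin 4} (hk : dartEdge x k ∈ ω) (hk' : dartEdge x' k' ∈ ω)
    (ha : a ∈ dartEdge x k) (ha' : a' ∈ dartEdge x' k')
    (hseg : segment ℝ (cpt x k) (ctr (σc a)) ⊆ Kset U) (hseg' : segment ℝ (cpt x' k') (ctr (σc a')) ⊆ Kset U)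
    (hchain : ReflTransGen (OpenStep U ω) a a') :
    ∃ K : Set ℂ, IsCompact K ∧ IsConnected K ∧ K ⊆ drawnC ω ∧ K ⊆ Kset U ∧ cpt x k ∈ K ∧ cpt x' k' ∈ K := by
  have segc : ∀ p q : ℂ, IsCompact (segment ℝ p q) := fun p q => by
    rw [segment_eq_image_lineMap]; exact isCompact_Icc.image AffineMap.lineMap_continuous
  -- the two end segments lie on the drawn edges of the contact darts
  have hsub : segment ℝ (cpt x k) (ctr (σc a)) ⊆ cellSeg x k := by
    refine (convex_cellSeg x k).segment_subset (cpt_mem_cellSeg x k) ?_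
    rcases mem_dartEdge_iff.1 ha with rfl | rfl
    · exact (ctr_mem_cellSeg a k).1
    · exact (ctr_mem_cellSeg x k).2
  have hsub' : segment ℝ (cpt x' k') (ctr (σc a')) ⊆ cellSeg x' k' := by
    refine (convex_cellSeg x' k').segment_subset (cpt_mem_cellSeg x' k') ?_
    rcases mem_dartEdge_iff.1 ha' with rfl | rfl
    · exact (ctr_mem_cellSeg a' k').1
    · exact (ctr_mem_cellSeg x' k').2
  have hO : segment ℝ (cpt x k) (ctr (σc a)) ⊆ drawnC ω := fun p hp => mem_drawnC_iff.2 ⟨x, k, hk, hsub hp⟩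
  have hO' : segment ℝ (cpt x' k') (ctr (σc a')) ⊆ drawnC ω := fun p hp => mem_drawnC_iff.2 ⟨x', k', hk', hsub' hp⟩
  have hc1 : IsConnected (segment ℝ (cpt x k) (ctr (σc a))) :=
    ⟨⟨_, left_mem_segment _ _ _⟩, (convex_segment _ _).isPreconnected⟩
  have hc2 : IsConnected (segment ℝ (cpt x' k') (ctr (σc a'))) :=
    ⟨⟨_, left_mem_segment _ _ _⟩, (convex_segment _ _).isPreconnected⟩
  rcases exists_connected_of_openStep hslit hchain with rfl | ⟨S, hSc, hS, hSO, hSK, haS, ha'S⟩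
  · refine ⟨segment ℝ (cpt x k) (ctr (σc a)) ∪ segment ℝ (cpt x' k') (ctr (σc a)), (segc _ _).union (segc _ _),
      hc1.union ⟨ctr (σc a), right_mem_segment _ _ _, right_mem_segment _ _ _⟩ hc2,
      union_subset hO hO', union_subset hseg hseg', Or.inl (left_mem_segment _ _ _), Or.inr (left_mem_segment _ _ _)⟩
  · refine ⟨(segment ℝ (cpt x k) (ctr (σc a)) ∪ S) ∪ segment ℝ (cpt x' k') (ctr (σc a')),
      ((segc _ _).union hSc).union (segc _ _),
      (hc1.union ⟨ctr (σc a), right_mem_segment _ _ _, haS⟩ hS).union ⟨ctr (σc a'), Or.inr ha'S, right_mem_segment _ _ _⟩ hc2,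
      union_subset (union_subset hO hSO) hO', union_subset (union_subset hseg hSK) hseg',
      Or.inl (Or.inl (left_mem_segment _ _ _)), Or.inr (left_mem_segment _ _ _)⟩

/-! ### (⇒) Crossings give open docking walks -/

/-- The contact point is not a cell centre of a site cell. [folklore] -/
theorem cpt_ne_ctr_σc (x : Site 2) (k : Fin 4) (v : Site 2) : cpt x k ≠ ctr (σc v) := by
  intro h
  obtain ⟨hre, him⟩ := seg2Pt_σc_re_im x k (1 / 4)
  rw [cpt] at h
  rw [h, (ctr_σc_re_im v).1] at hre
  rw [h, (ctr_σc_re_im v).2] at him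
  fin_cases k <;> rw [toComplex_cornerUnit_table] at hre him <;>
    simp only [Complex.one_re, Complex.one_im, Complex.I_re, Complex.I_im, Complex.neg_re, Complex.neg_im,
      neg_zero, mul_zero, mul_one, mul_neg, add_zero] at hre him
  · have : (4 : ℝ) * (v 0 - x 0) = 1 := by linarith
    have h' : (4 : ℤ) * (v 0 - x 0) = 1 := by exact_mod_cast this
    omega
  · have : (4 : ℝ) * (v 1 - x 1) = 1 := by linarith
    have h' : (4 : ℤ) * (v 1 - x 1) = 1 := by exact_mod_cast this
    omega
  · have : (4 : ℝ) * (x 0 - v 0) = 1 := by linarith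
    have h' : (4 : ℤ) * (x 0 - v 0) = 1 := by exact_mod_cast this
    omega
  · have : (4 : ℝ) * (x 1 - v 1) = 1 := by linarith
    have h' : (4 : ℤ) * (x 1 - v 1) = 1 := by exact_mod_cast this
    omega

/-- A contact point lies on the drawn edge of its own edge only. [folklore] -/
theorem dartEdge_eq_of_cpt_mem_cellSeg {x y : Site 2} {k m : Fin 4} (h : cpt x k ∈ cellSeg y m) :
    dartEdge y m = dartEdge x k := by
  by_contra hne
  obtain ⟨v, -, -, hv⟩ := cellSeg_inter_cellSeg h (cpt_mem_cellSeg x k) hne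
  exact cpt_ne_ctr_σc x k v hv

/-- Only finitely many drawn edges meet `K`. [folklore] -/
theorem finite_setOf_cellSeg_inter_nonempty (U : Finset (Site 2)) :
    {d : Site 2 × Fin 4 | (cellSeg d.1 d.2 ∩ Kset U).Nonempty}.Finite := by
  classical
  -- such a dart has one of its three cells in `U`; recover the dart from the cell and the direction
  set half : Site 2 → Site 2 := fun c i => c i / 2 with hhalf
  have half_σc : ∀ x, half (σc x) = x := fun x => by funext i; simp [hhalf, σc_apply]
  set F : Finset (Site 2 × Fin 4) := (U ×ˢ (Finset.univ : Finset (Fin 4))).image (fun ck => (half ck.1, ck.2)) ∪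
    (U ×ˢ (Finset.univ : Finset (Fin 4))).image (fun ck => (half (ck.1 - cornerUnit ck.2), ck.2)) ∪
    (U ×ˢ (Finset.univ : Finset (Fin 4))).image (fun ck => (half ck.1 - cornerUnit ck.2, ck.2)) with hF
  refine F.finite_toSet.subset ?_
  rintro ⟨x, k⟩ ⟨p, ⟨t, ht, rfl⟩, hpK⟩
  rw [Kset, mem_iUnion₂] at hpK
  obtain ⟨c, hcU, hc⟩ := hpK
  simp only [hF, Finset.coe_union, Finset.coe_image, Finset.coe_product, Finset.coe_univ, mem_union, mem_image,
    mem_prod, mem_univ, and_true, Prod.exists, Prod.mk.injEq]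
  rcases exists_of_seg2Pt_mem_sqCell ht hc with rfl | rfl | rfl
  · exact Or.inl (Or.inl ⟨σc x, k, hcU, half_σc x, rfl⟩)
  · refine Or.inl (Or.inr ⟨σc x + cornerUnit k, k, hcU, ?_, rfl⟩)
    rw [add_sub_cancel_right, half_σc]
  · refine Or.inr ⟨σc x + cornerUnit k + cornerUnit k, k, hcU, ?_, rfl⟩
    rw [← σc_add_cornerUnit, half_σc, add_sub_cancel_right]

/-- **(⇒) Crossings give open docking walks.**  Let `C` be a connected subset of the open drawing
inside `K` meeting two subsets `S₀`, `S₂` of the frontier of `K`.  Then there are open contact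
darts `(x, k)`, `(x', k')` with contact points in `C ∩ S₀`, `C ∩ S₂` (exactly one of the two cells of
each contact side in `U`), inner sites `a ∈ {x, x + e_k}`, `a' ∈ {x', x' + e_{k'}}` with site cells
in `U` — unless the contact dart has no endpoint with site cell in `U` — and a chain of open steps
from `a` to `a'`.  Precisely: every endpoint of the first contact edge with site cell in `U` is
chained to every such endpoint of the last. [cite: SchrammSmirnov2011, proof of Thm 1.5 (C)] -/
theorem exists_chain_of_connected {U : Finset (Site 2)} {ω : BondConfig (Site 2)} {C S₀ S₂ : Set ℂ}
    (hC : IsConnected C) (hCO : C ⊆ drawnC ω) (hCK : C ⊆ Kset U) (hS₀ : S₀ ⊆ frontier (Kset U))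
    (hS₂ : S₂ ⊆ frontier (Kset U)) (h₀ : (C ∩ S₀).Nonempty) (h₂ : (C ∩ S₂).Nonempty) :
    ∃ (x : Site 2) (k : Fin 4) (x' : Site 2) (k' : Fin 4),
      dartEdge x k ∈ ω ∧ dartEdge x' k' ∈ ω ∧ cpt x k ∈ C ∩ S₀ ∧ cpt x' k' ∈ C ∩ S₂ ∧
      ((σc x ∈ U ∧ βc x k ∉ U) ∨ (σc x ∉ U ∧ βc x k ∈ U)) ∧
      ((σc x' ∈ U ∧ βc x' k' ∉ U) ∨ (σc x' ∉ U ∧ βc x' k' ∈ U)) ∧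
      ∀ a ∈ dartEdge x k, σc a ∈ U → ∀ a' ∈ dartEdge x' k', σc a' ∈ U → ReflTransGen (OpenStep U ω) a a' := by
  classical
  -- the pieces of the open drawn edges
  set P : Site 2 × Fin 4 → Set ℂ := fun d => if dartEdge d.1 d.2 ∈ ω then cellSeg d.1 d.2 ∩ Kset U else ∅ with hP
  have hPclosed : ∀ d, IsClosed (P d) := by
    intro d
    simp only [hP]
    split_ifs
    · rw [cellSeg_eq_segment, segment_eq_image_lineMap]
      exact (isCompact_Icc.image AffineMap.lineMap_continuous).isClosed.inter (isClosed_Kset U)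
    · exact isClosed_empty
  have hPfin : {d | (P d).Nonempty}.Finite := by
    refine (finite_setOf_cellSeg_inter_nonempty U).subset fun d hd => ?_
    simp only [mem_setOf_eq, hP] at hd ⊢
    split_ifs at hd with h
    · exact hd
    · exact absurd hd Set.not_nonempty_empty
  have hCsub : C ⊆ ⋃ d, P d := by
    intro p hp
    obtain ⟨x, k, hk, hpx⟩ := mem_drawnC_iff.1 (hCO hp)
    exact mem_iUnion.2 ⟨(x, k), by simp only [hP, if_pos hk]; exact ⟨hpx, hCK hp⟩⟩
  -- the two contact darts
  obtain ⟨p₀, hp₀C, hp₀S⟩ := h₀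
  obtain ⟨p₂, hp₂C, hp₂S⟩ := h₂
  obtain ⟨x₀, k₀, hk₀, hp₀x⟩ := mem_drawnC_iff.1 (hCO hp₀C)
  obtain ⟨x₂, k₂, hk₂, hp₂x⟩ := mem_drawnC_iff.1 (hCO hp₂C)
  obtain ⟨x, k, hxk, rfl, hside⟩ := exists_cpt_of_mem_frontier hp₀x (hS₀ hp₀S)
  obtain ⟨x', k', hxk', rfl, hside'⟩ := exists_cpt_of_mem_frontier hp₂x (hS₂ hp₂S)
  rw [← hxk] at hk₀
  rw [← hxk'] at hk₂
  refine ⟨x, k, x', k', hk₀, hk₂, ⟨hp₀C, hp₀S⟩, ⟨hp₂C, hp₂S⟩, hside, hside', ?_⟩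
  -- the chain of pieces
  have hP₀ : cpt x k ∈ P (x, k) := by simp only [hP, if_pos hk₀]; exact ⟨cpt_mem_cellSeg x k, hCK hp₀C⟩
  have hP₂ : cpt x' k' ∈ P (x', k') := by simp only [hP, if_pos hk₂]; exact ⟨cpt_mem_cellSeg x' k', hCK hp₂C⟩
  have hchain := QuadCrossing.exists_reflTransGen_of_isPreconnected P hPclosed hPfin hC.isPreconnected hCsub
    (i₁ := (x, k)) (i₂ := (x', k')) ⟨_, hp₀C, hP₀⟩ ⟨_, hp₂C, hP₂⟩
  -- invariant along the chain of pieces: every endpoint of the current (open) edge whose site cell is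
  -- in `U` is chained by open steps from every such endpoint of the first edge
  intro a ha haU
  have key : ∀ d : Site 2 × Fin 4, ReflTransGen (fun i j => (C ∩ P j).Nonempty ∧ (P i ∩ P j).Nonempty) (x, k) d →
      dartEdge d.1 d.2 ∈ ω ∧ ∀ b ∈ dartEdge d.1 d.2, σc b ∈ U → ReflTransGen (OpenStep U ω) a b := by
    intro d hd
    induction hd with
    | refl =>
      refine ⟨hk₀, fun b hb hbU => ?_⟩
      -- within the first edge: `b = a` or an open step
      by_cases hab : b = a
      · rw [hab]
      · obtain ⟨m, hm⟩ := exists_eq_dartEdge_of_mem (dartEdge_mem_edgeSet x k) ha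
        have hb' : b = a + cornerUnit m := by
          have : b ∈ dartEdge a m := hm ▸ hb
          rcases mem_dartEdge_iff.1 this with h | h
          · exact absurd h hab
          · exact h
        exact ReflTransGen.single ⟨haU, hbU, m, hb', hm ▸ hk₀⟩
    | @tail i j _ hst ih =>
      obtain ⟨hCj, q, hqi, hqj⟩ := hst
      obtain ⟨hiω, hi⟩ := ih
      have hjω : dartEdge j.1 j.2 ∈ ω := by
        by_contra h
        simp only [hP, if_neg h] at hqj
        exact (Set.mem_empty_iff_false _).1 hqj
      refine ⟨hjω, fun b hb hbU => ?_⟩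
      simp only [hP, if_pos hiω, if_pos hjω] at hqi hqj
      by_cases hsame : dartEdge i.1 i.2 = dartEdge j.1 j.2
      · exact hi b (hsame ▸ hb) hbU
      · -- distinct edges meet at the centre of a common endpoint `v`, whose site cell is in `U`
        obtain ⟨v, hvi, hvj, hqv⟩ := cellSeg_inter_cellSeg hqi.1 hqj.1 hsame
        have hvU : σc v ∈ U := ctr_σc_mem_Kset_iff.1 (hqv ▸ hqj.2)
        have hav : ReflTransGen (OpenStep U ω) a v := hi v hvi hvU
        by_cases hbv : b = v
        · rw [hbv]; exact hav
        · obtain ⟨m, hm⟩ := exists_eq_dartEdge_of_mem (dartEdge_mem_edgeSet j.1 j.2) hvj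
          have hb' : b = v + cornerUnit m := by
            have : b ∈ dartEdge v m := hm ▸ hb
            rcases mem_dartEdge_iff.1 this with h | h
            · exact absurd h hbv
            · exact h
          exact hav.tail ⟨hvU, hbU, m, hb', hm ▸ hjω⟩
  intro a' ha' ha'U
  exact (key (x', k') hchain).2 a' ha' ha'U

end CellComplex

end Literature.Probability.Percolation

end
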